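import Summits.QuantumAdvantage.QuantumAdvantage.Theorems.InnerDegreeLawsB

set_option linter.dupNamespace false

/-!
# InnerDegreeLawsE (lens 4, g27; part E = LAND-PACKAGE-3 delta 1) — LAW R: perfection with one extra register forces rank ≤ (n+1)·2p^k + 1 on EVERY combinatorial rectangle / flattening of that register's live firing set (the rank method enters through the deletion identity of part B)

Blocker `X = AbsorptionDial.NoPerfectPolyOdd` (item 28487); decomp-qadv lens 4 (minimal-counterexample / extremal reduction), g27.  The NODE record
(rung `QuadFormNoPerfectOdd`, residual `QuadLiftOdd`, sub-rung `OneQuadNoPerfectOdd`, floor `linFormFloor`, `x_iff_pieces`) lives in the cell file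
`g27/InnerDegreeDial.lean` and is NOT landed (Prop-definition node pieces); the tree parts are Prop-definition-free and state only unconditional LAWS.
Parts A–D (LAW C/Q/E/S/C⁺, first-moment subcubes, deletion identity, normal form) are LANDED (p825604/p825613/p825616/p825666);
parts E–F are the LAND-PACKAGE-3 deltas on top of them.  Kernel-checked content:

* §11 **LAW R (`flatRank_le_of_perfect`, `loss_of_flatRank`).**  Registers `k`-form except `g₀` and PERFECT ⇒ for EVERY bipartition of the
  coordinates the `0/1` flattening matrix of `g₀`'s live firing set has rank `≤ (n+1)·2p^k + 1` over `𝔽₂(μ_{3p})` (deletion identity + the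
  char-two expansion: `1 + W'` is all-ones plus `(n+1)·2p^k` rank-one flattenings of cube characters).  Contrapositive: ONE high-rank
  flattening kills — the face (c0) becomes linear algebra («FlatRankQuad»).  Stated for arbitrary COMBINATORIAL RECTANGLES
  (`rectRank_le_of_perfect`, `loss_of_rectRank`; flattenings are the special case `flat_eq_rect`).
-/

open Finset
open Summit.QuantumAdvantage.AdviceFreeQNC0

namespace Summit.QuantumAdvantage.QuantumAdvantage.Theorems.InnerDegreeDial

/-! ### §11 LAW R: perfection with ONE extra register forces LOW RANK of every combinatorial rectangle of that register's live firing set -/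

section LawR

variable {p : ℕ} [Fact p.Prime]

/-- the coefficient field `𝔽₂(μ_{3p})` of the char-two product-span engine (`Coset21.exists_charTwo_roots`) -/
abbrev Kp (p : ℕ) : Type := CyclotomicField (3 * p) (ZMod 2)

/-- rank subadditivity (Mathlib has no `Matrix.rank_add_le`; same proof as the tree's `rank_sum_le`) -/
theorem rank_add_le' {K : Type*} [Field K] {ι₁ ι₂ : Type*} [Fintype ι₂] (A B : Matrix ι₁ ι₂ K) :
    (A + B).rank ≤ A.rank + B.rank := by
  classical
  unfold Matrix.rank
  rw [Matrix.mulVecLin_add]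
  exact (Submodule.finrank_mono (LinearMap.range_add_le _ _)).trans (Submodule.finrank_add_le_finrank_add_finrank _ _)

/-- rank subadditivity over a finite sum -/
theorem rank_sum_le' {K : Type*} [Field K] {ι ι₁ ι₂ : Type*} [Fintype ι₂] (S : Finset ι) (A : ι → Matrix ι₁ ι₂ K) :
    (∑ c ∈ S, A c).rank ≤ ∑ c ∈ S, (A c).rank := by
  classical
  induction S using Finset.induction_on with
  | empty => simp
  | insert a S ha ih =>
    rw [Finset.sum_insert ha, Finset.sum_insert ha]
    exact (rank_add_le' _ _).trans (Nat.add_le_add_left ih _)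

variable {n : ℕ}

/-- union of two inputs (pointwise OR) -/
def bor (x v : Fin n → Bool) : Fin n → Bool := fun i => x i || v i

/-- cube characters are multiplicative over inputs with disjoint supports (they are rank one on every combinatorial rectangle) -/
theorem cubeChar_bor {K : Type*} [Field K] (z : Fin n → K) (x v : Fin n → Bool) (hd : ∀ i, ¬ (x i = true ∧ v i = true)) :
    Coset21.CharTwoKill.cubeChar z (bor x v) = Coset21.CharTwoKill.cubeChar z x * Coset21.CharTwoKill.cubeChar z v := by
  unfold Coset21.CharTwoKill.cubeChar bor
  rw [← Finset.prod_mul_distrib]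
  refine prod_congr rfl fun i _ => ?_
  have := hd i
  cases hx : x i <;> cases hv : v i <;> simp_all

/-- the COMBINATORIAL RECTANGLE of a Boolean function: rows `X i`, columns `Y j` (inputs of disjoint support), entry `[f (X i ∪ Y j)]` as `0/1 ∈ K` -/
def rect (K : Type*) [Zero K] [One K] {ι ι' : Type*} (f : (Fin n → Bool) → Bool) (X : ι → Fin n → Bool) (Y : ι' → Fin n → Bool) :
    Matrix ι ι' K :=
  Matrix.of fun i j => if f (bor (X i) (Y j)) = true then 1 else 0

/-- **LAW R (rectangle-rank reduction).**  If every register except `g₀` is a function of `k` linear forms `mod p` and the strategy is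
PERFECT, then EVERY combinatorial rectangle (rows and columns = input families of disjoint supports) of `g₀`'s live firing set
`u ↦ [y g₀ u ∧ g₀ live at u]` has rank `≤ (n+1)·2p^k + 1` over `𝔽₂(μ_{3p})`: by the deletion identity the live firing indicator equals
`1 + W'` with `W'` the char-two expansion (`Coset21.CharTwoKill.card_fire_eq_WsumK`) of the silenced `k`-form strategy — a combination of
`(n+1)·2p^k` cube characters, each multiplicative over disjoint supports, hence rank one on the rectangle. -/
theorem rectRank_le_of_perfect (hp5 : 5 ≤ p) {k : ℕ} {ι ι' : Type*} [Fintype ι] [Fintype ι'] (c : ℕ)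
    (y : Fin (n + 1) → (Fin n → Bool) → Bool) (g₀ : Fin (n + 1))
    (lam : Fin (n + 1) → Fin k → Fin n → ZMod p) (F : Fin (n + 1) → (Fin k → ZMod p) → Bool)
    (hF : ∀ g, g ≠ g₀ → ∀ u, y g u = F g (fun j => ∑ i, if u i = true then lam g j i else 0))
    (hperf : ∀ u, ringWinU c y u = true)
    (X : ι → Fin n → Bool) (Y : ι' → Fin n → Bool) (hd : ∀ i j l, ¬ (X i l = true ∧ Y j l = true)) :
    (rect (Kp p) (fun u => y g₀ u && liveCut c u g₀) X Y).rank ≤ (n + 1) * (p ^ k * 2) + 1 := by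
  classical
  obtain ⟨hK, ω, ζ, hω, hζ⟩ := Coset21.exists_charTwo_roots p hp5
  haveI := hK
  set F' : Fin (n + 1) → (Fin k → ZMod p) → Bool := Function.update F g₀ (fun _ => false) with hF'
  set κ : Fin (n + 1) → ℕ := fun g => c + g.val with hκ
  set w : Fin (n + 1) → Fin n → ℕ := fun g i => Coset21.CharTwoKill.ww g.val i with hw
  -- (1) the silenced strategy is `k`-form with table `F'`
  have hy' : ∀ g u, silence y g₀ g u = F' g (Coset21.CharTwoKill.kForm lam g u) := by
    intro g u
    unfold silence Coset21.CharTwoKill.kForm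
    by_cases hg : g = g₀
    · subst hg
      simp [hF']
    · rw [Function.update_of_ne hg, hF', Function.update_of_ne hg]
      exact hF g hg u
  -- (2) the char-two expansion of the silenced fire count
  have hexp : ∀ u, (((univ.filter fun g : Fin (n + 1) =>
        silence y g₀ g u = true ∧ (c + g.val + walkExp u g.val) % 3 ≠ 0).card : ℕ) : Kp p)
      = Coset21.CharTwoKill.WsumK ω ζ hω lam F' κ w u := by
    intro u
    rw [← Coset21.CharTwoKill.card_fire_eq_WsumK ω ζ hω lam F' κ w hp5 hζ u]
    congr 2
    refine filter_congr fun g _ => ?_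
    rw [hy' g u, Coset21.CharTwoKill.walkExp_eq_sum]
    unfold Coset21.CharTwoKill.wForm
    simp only [hκ, hw, add_assoc]
  -- (3) pointwise: the live firing indicator is `1 + W'`
  have h11 : (1 : Kp p) + 1 = 0 := CharTwo.add_self_eq_zero 1
  have hpt : ∀ u, (if (y g₀ u && liveCut c u g₀) = true then (1 : Kp p) else 0)
      = 1 + Coset21.CharTwoKill.WsumK ω ζ hω lam F' κ w u := by
    intro u
    have hl := (perfect_iff_lossSet c y g₀).mp hperf u
    unfold ringWinU at hl
    rw [← hexp u, CharP.cast_eq_mod (Kp p) 2]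
    set N := (univ.filter fun g : Fin (n + 1) =>
      silence y g₀ g u = true ∧ (c + g.val + walkExp u g.val) % 3 ≠ 0).card with hN
    cases hb : (y g₀ u && liveCut c u g₀)
    · rw [hb] at hl
      have h1 : N % 2 = 1 := by simpa using hl
      rw [h1, Nat.cast_one, h11]
      simp
    · rw [hb] at hl
      have h0 : N % 2 = 0 := by
        have : ¬ (N % 2 = 1) := by simpa using hl
        omega
      rw [h0, Nat.cast_zero, add_zero]
      simp
  -- (4) the matrix identity: all-ones + one rank-one matrix per term
  set V : Coset21.CharTwoKill.TermK p (Fin (n + 1)) k → Matrix ι ι' (Kp p) := fun t =>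
    Matrix.vecMulVec
      (fun i => Coset21.CharTwoKill.coefK ω ζ hω F' κ t
        * Coset21.CharTwoKill.cubeChar (Coset21.CharTwoKill.zvalK ω ζ hω lam w t) (X i))
      (fun j => Coset21.CharTwoKill.cubeChar (Coset21.CharTwoKill.zvalK ω ζ hω lam w t) (Y j))
    with hV
  have hmat : rect (Kp p) (fun u => y g₀ u && liveCut c u g₀) X Y
      = Matrix.vecMulVec (fun _ => (1 : Kp p)) (fun _ => 1) + ∑ t, V t := by
    ext i j
    rw [rect, Matrix.of_apply, hpt, Matrix.add_apply, Matrix.vecMulVec_apply, one_mul, Matrix.sum_apply]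
    unfold Coset21.CharTwoKill.WsumK
    congr 1
    refine sum_congr rfl fun t _ => ?_
    simp only [hV, Matrix.vecMulVec_apply]
    rw [cubeChar_bor _ _ _ (hd i j), mul_assoc]
  rw [hmat]
  refine (rank_add_le' _ _).trans ?_
  have h1 : (Matrix.vecMulVec (fun _ : ι => (1 : Kp p)) (fun _ : ι' => 1)).rank ≤ 1 :=
    Matrix.rank_vecMulVec_le _ _
  have h2 : (∑ t, V t).rank ≤ ∑ t ∈ (univ : Finset (Coset21.CharTwoKill.TermK p (Fin (n + 1)) k)), 1 :=
    (rank_sum_le' univ V).trans (sum_le_sum fun t _ => by rw [hV]; exact Matrix.rank_vecMulVec_le _ _)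
  rw [sum_const, smul_eq_mul, mul_one, card_univ, Coset21.CharTwoKill.card_TermK, Fintype.card_fin] at h2
  omega

/-- **LAW R, contrapositive (the rank kill of the one-dense-register face (c0)).**  Registers `k`-form except `g₀`; if SOME combinatorial
rectangle of `g₀`'s live firing set has rank `> (n+1)·2p^k + 1` over `𝔽₂(μ_{3p})`, the strategy is not perfect.  With LAW C (which kills
`g₀` reading `≤ c·n` forms outright) the sub-rung `OneQuadNoPerfectOdd` thus reduces to linear algebra: «FlatRankQuad» — the pattern matrices
`[G(ℓ(u), Q(u)) ∧ live]` of quadratic forms of `q`-rank `≥ εn` have some rectangle of rank `> (n+1)·2p^k + 1` (NODE-g27 §3 (c0)). -/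
theorem loss_of_rectRank (hp5 : 5 ≤ p) {k : ℕ} {ι ι' : Type*} [Fintype ι] [Fintype ι'] (c : ℕ)
    (y : Fin (n + 1) → (Fin n → Bool) → Bool) (g₀ : Fin (n + 1))
    (lam : Fin (n + 1) → Fin k → Fin n → ZMod p) (F : Fin (n + 1) → (Fin k → ZMod p) → Bool)
    (hF : ∀ g, g ≠ g₀ → ∀ u, y g u = F g (fun j => ∑ i, if u i = true then lam g j i else 0))
    (X : ι → Fin n → Bool) (Y : ι' → Fin n → Bool) (hd : ∀ i j l, ¬ (X i l = true ∧ Y j l = true))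
    (hrank : (n + 1) * (p ^ k * 2) + 1 < (rect (Kp p) (fun u => y g₀ u && liveCut c u g₀) X Y).rank) :
    ∃ u, ringWinU c y u = false := by
  by_contra hno
  push Not at hno
  have hperf : ∀ u, ringWinU c y u = true := fun u => by
    cases h : ringWinU c y u
    · exact absurd h (hno u)
    · rfl
  exact absurd (rectRank_le_of_perfect hp5 c y g₀ lam F hF hperf X Y hd) (not_le.mpr hrank)

variable {a b : ℕ}

/-- gluing the two halves of an input along a bipartition `e : Fin n ≃ Fin a ⊕ Fin b` of the coordinates -/
def glue (e : Fin n ≃ Fin a ⊕ Fin b) (x : Fin a → Bool) (v : Fin b → Bool) : Fin n → Bool := fun i => Sum.elim x v (e i)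

/-- the flattening of a Boolean function along the bipartition `e`, as a `0/1` matrix over `K` -/
def flat (K : Type*) [Zero K] [One K] (e : Fin n ≃ Fin a ⊕ Fin b) (f : (Fin n → Bool) → Bool) :
    Matrix (Fin a → Bool) (Fin b → Bool) K :=
  Matrix.of fun x v => if f (glue e x v) = true then 1 else 0

/-- a flattening is the rectangle of the two zero-padded half-input families -/
theorem flat_eq_rect (K : Type*) [Zero K] [One K] (e : Fin n ≃ Fin a ⊕ Fin b) (f : (Fin n → Bool) → Bool) :
    flat K e f = rect K f (fun x => glue e x (fun _ => false)) (fun v => glue e (fun _ => false) v) := by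
  ext x v
  have hg : glue e x v = bor (glue e x (fun _ => false)) (glue e (fun _ => false) v) := by
    funext i
    simp only [glue, bor]
    cases e i <;> simp
  rw [flat, rect, Matrix.of_apply, Matrix.of_apply, hg]

/-- **LAW R for flattenings**: perfect with `k`-form registers except `g₀` ⇒ every flattening of `g₀`'s live firing set has rank
`≤ (n+1)·2p^k + 1` over `𝔽₂(μ_{3p})`. -/
theorem flatRank_le_of_perfect (hp5 : 5 ≤ p) {k : ℕ} (e : Fin n ≃ Fin a ⊕ Fin b) (c : ℕ)
    (y : Fin (n + 1) → (Fin n → Bool) → Bool) (g₀ : Fin (n + 1))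
    (lam : Fin (n + 1) → Fin k → Fin n → ZMod p) (F : Fin (n + 1) → (Fin k → ZMod p) → Bool)
    (hF : ∀ g, g ≠ g₀ → ∀ u, y g u = F g (fun j => ∑ i, if u i = true then lam g j i else 0))
    (hperf : ∀ u, ringWinU c y u = true) :
    (flat (Kp p) e (fun u => y g₀ u && liveCut c u g₀)).rank ≤ (n + 1) * (p ^ k * 2) + 1 := by
  rw [flat_eq_rect]
  refine rectRank_le_of_perfect hp5 c y g₀ lam F hF hperf _ _ fun x v i => ?_
  simp only [glue]
  cases e i <;> simp

/-- LAW R for flattenings, contrapositive -/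
theorem loss_of_flatRank (hp5 : 5 ≤ p) {k : ℕ} (e : Fin n ≃ Fin a ⊕ Fin b) (c : ℕ)
    (y : Fin (n + 1) → (Fin n → Bool) → Bool) (g₀ : Fin (n + 1))
    (lam : Fin (n + 1) → Fin k → Fin n → ZMod p) (F : Fin (n + 1) → (Fin k → ZMod p) → Bool)
    (hF : ∀ g, g ≠ g₀ → ∀ u, y g u = F g (fun j => ∑ i, if u i = true then lam g j i else 0))
    (hrank : (n + 1) * (p ^ k * 2) + 1 < (flat (Kp p) e (fun u => y g₀ u && liveCut c u g₀)).rank) :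
    ∃ u, ringWinU c y u = false := by
  by_contra hno
  push Not at hno
  have hperf : ∀ u, ringWinU c y u = true := fun u => by
    cases h : ringWinU c y u
    · exact absurd h (hno u)
    · rfl
  exact absurd (flatRank_le_of_perfect hp5 e c y g₀ lam F hF hperf) (not_le.mpr hrank)

end LawR

end Summit.QuantumAdvantage.QuantumAdvantage.Theorems.InnerDegreeDial
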